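import Literature.NumberTheory.LFunctions.EulerMaclaurinZeta
import Literature.NumberTheory.LFunctions.DirichletPolynomialMeanValue
import Literature.NumberTheory.LFunctions.NymanBeurlingDirichlet
import Mathlib.Analysis.SpecialFunctions.Gaussian.GaussianIntegral
import HarnessLib

/-!
# A mean-square lower bound for `ζ` on the critical line: `∫_T^{2T} |ζ(½+it)|² dt ≥ T/64`

Topic `Literature/NumberTheory/LFunctions`. Everything in this file is PROVED (no named facts).
The classical mean value theorem of Hardy and Littlewood (Titchmarsh, *The Theory of the
Riemann Zeta-Function*, 2nd ed., Theorem 7.3: `∫_0^T |ζ(½+it)|² dt ∼ T log T`) is proved in the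
book from the approximate functional equation. Downstream (Bettin–Gonek 2017, Theorem 2, file
`Literature/Barriers/RiemannHypothesis/BettinGonek2017Thm2Proofs.lean`) only the order of
magnitude `∫_T^{2T} |ζ(½+it)|² dt ≫ T` is needed, and this weak form has a short self-contained
proof, given here with explicit constants:

* `Literature.NumberTheory.LFunctions.ZetaMeanSquare.integral_norm_sq_riemannZeta_Icc_ge` —
  for `T ≥ 3·10⁵`, `T/64 ≤ ∫_T^{2T} |ζ(½+it)|² dt`;
* `Literature.NumberTheory.LFunctions.exists_integral_norm_sq_riemannZeta_Icc_ge` — the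
  `∃ c > 0, ∃ T₁, ∀ T ≥ T₁, c T ≤ ∫_T^{2T} |ζ(½+it)|² dt` form consumed downstream.

## The argument

Let `K(v) = e^{-v²/16}` (`ZetaMeanSquare.gaussK`; `∫ K = 4√π`, `∫ e^{iξv} K(v) dv = 4√π e^{-4ξ²}`).

1. *Smoothed first moment.* For `T₀ ≥ 4·10⁴` and `N = ⌊T₀⌋ + 1`, the Euler–Maclaurin formula of
   order `0` (`Literature.NumberTheory.LFunctions.riemannZeta_eq_eulerMaclaurin₀`, Edwards §6.4
   (1)) `ζ(s) = ∑_{n<N} n^{-s} + N^{1-s}/(s-1) + ½N^{-s} - s∫_N^∞ B̄₁(x)x^{-s-1} dx`, `s = ½ + it`,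
   is integrated against `K(t - T₀)`: the term `n = 1` gives exactly `4√π`
   (`integral_one_cpow_mul_gaussK`); the terms `2 ≤ n < N` give `n^{-½-iT₀} 4√π e^{-4 log² n}`,
   of total size `≤ 4√π ∑_{n ≥ 2} ½ n^{-2} ≤ 2√π` (`norm_integral_emSum_sub_le`, using
   `log 2 > 5/8`); the two boundary terms are `O(√N/T₀)` and `O(N^{-1/2})`
   (`norm_integral_emBdry_le`, `norm_integral_emHalf_le`); and the remainder is, after Fubini,
   `∫_N^∞ B̄₁(x) x^{-3/2} J(-log x) dx` with the weighted Gaussian transform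
   `J(ξ) = ∫ (½+it) e^{iξt} K(t-T₀) dt = e^{iξT₀} 4√π e^{-4ξ²} (½ - 8ξ + iT₀)`
   (`integral_line_mul_cexp_mul_gaussK`, from `∫ v e^{iξv}K = 8iξ ∫ e^{iξv} K` by integrating a
   derivative over `ℝ`), which is `O((9+T₀) N^{-7/2})` (`norm_integral_emTail_le`). Hence
   `‖∫ ζ(½+it) K(t-T₀) dt‖ ≥ √π` (`sqrt_pi_le_norm_smoothedFirstMoment`).
2. *Cauchy–Schwarz* (in AM–GM form): `√π/4 ≤ ∫ |ζ(½+it)|² K(t-T₀) dt` (`smoothedMeanSquare_ge`).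
3. *Localisation and averaging.* For `T₀ ∈ [5T/4, 7T/4]` the part of the Gaussian weight outside
   `[T, 2T]` contributes `≤ 8448 T² e^{-T²/1024} ≤ 1/5` once `T ≥ 3·10⁵` (`|ζ(½+it)| ≤ 2 + 2|t|`,
   Titchmarsh (2.12.2)), so `√π/8 ≤ ∫_T^{2T} |ζ(½+it)|² K(t-T₀) dt`
   (`interval_smoothedMeanSquare_ge`); integrating over `T₀ ∈ [5T/4, 7T/4]`, swapping the
   integrals (Fubini on a compact rectangle) and using `∫ K(t-T₀) dT₀ ≤ 4√π` gives
   `(T/2)(√π/8) ≤ 4√π ∫_T^{2T} |ζ(½+it)|² dt`.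

## References

* [Titchmarsh1986] E. C. Titchmarsh, *The Theory of the Riemann Zeta-Function*, 2nd ed. revised
  by D. R. Heath-Brown, Oxford 1986: Theorem 7.3 (the mean value theorem `∼ T log T`, of which
  only the weak consequence `≫ T` on `[T, 2T]` is proved here), §2.12 eq. (2.12.2).
* [Edwards1974] H. M. Edwards, *Riemann's Zeta Function*, §6.4 eq. (1) (Euler–Maclaurin).

## Design notes

* The constants (`4·10⁴`, `3·10⁵`, `1/64`) are far from optimal; only `c > 0` matters downstream.
* No contour integration is used: the smoothing kernel is applied on the critical line itself,
  the only oscillatory input being the Gaussian Fourier transform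
  (`Literature.NumberTheory.LFunctions.integral_exp_mul_I_mul_gaussian`).
* What is NOT here: the asymptotic `∼ T log T` (Theorem 7.3 itself) and any upper bound.
-/

noncomputable section

open Complex MeasureTheory Set Filter Real

namespace Literature.NumberTheory.LFunctions

namespace ZetaMeanSquare


/-- The Gaussian kernel `K(v) = e^{-v²/16}` used to smooth the critical line. [folklore] -/
def gaussK (v : ℝ) : ℝ := Real.exp (-(4 ^ 2)⁻¹ * v ^ 2)

/-- `K > 0`. [folklore] -/
theorem gaussK_pos (v : ℝ) : 0 < gaussK v := Real.exp_pos _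

/-- `K` is continuous. [folklore] -/
@[fun_prop]
theorem continuous_gaussK : Continuous gaussK := by
  unfold gaussK; fun_prop

/-- `‖e^{iab}‖ = 1` for real `a, b`. [folklore] -/
theorem norm_cexp_mul_mul_I (a b : ℝ) : ‖cexp ((a : ℂ) * b * I)‖ = 1 := by
  rw [← Complex.ofReal_mul]; exact Complex.norm_exp_ofReal_mul_I _

/-- `K` is integrable. [folklore] -/
theorem integrable_gaussK : Integrable gaussK :=
  integrable_exp_neg_mul_sq (by norm_num)

/-- `∫ K = 4√π`. [folklore] -/
theorem integral_gaussK : ∫ v, gaussK v = 4 * Real.sqrt π := by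
  unfold gaussK
  rw [integral_gaussian]
  rw [show π / (4 ^ 2 : ℝ)⁻¹ = 4 ^ 2 * π by field_simp]
  rw [Real.sqrt_mul (by norm_num), Real.sqrt_sq (by norm_num)]

/-- `v K(v)` is integrable. [folklore] -/
theorem integrable_mul_gaussK : Integrable fun v : ℝ ↦ v * gaussK v :=
  integrable_mul_exp_neg_mul_sq (by norm_num)

/-- `v² K(v)` is integrable. [folklore] -/
theorem integrable_sq_mul_gaussK : Integrable fun v : ℝ ↦ v ^ 2 * gaussK v := by
  have := integrable_rpow_mul_exp_neg_mul_sq (b := (4 ^ 2 : ℝ)⁻¹) (by norm_num)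
    (by norm_num : (-1 : ℝ) < 2)
  simpa [Real.rpow_two, gaussK] using this

/-- Integrability of anything dominated by `(a + b t²) K(t - T₀)`. [folklore] -/
theorem integrable_of_norm_le_mul_gaussK {E : Type*} [NormedAddCommGroup E] {F : ℝ → E}
    (hF : AEStronglyMeasurable F volume) {a b T₀ : ℝ}
    (h : ∀ t, ‖F t‖ ≤ (a + b * t ^ 2) * gaussK (t - T₀)) : Integrable F := by
  have hG : Integrable fun v : ℝ ↦ (a + b * (v + T₀) ^ 2) * gaussK v := by
    have h1 := (integrable_gaussK.const_mul (a + b * T₀ ^ 2)).add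
      (((integrable_mul_gaussK.const_mul (2 * b * T₀))).add (integrable_sq_mul_gaussK.const_mul b))
    refine h1.congr (Eventually.of_forall fun v ↦ ?_)
    simp only [Pi.add_apply]
    ring
  have hG' : Integrable fun t : ℝ ↦ (a + b * t ^ 2) * gaussK (t - T₀) := by
    have := hG.comp_sub_right T₀
    refine this.congr (Eventually.of_forall fun t ↦ ?_)
    simp only [sub_add_cancel]
  exact hG'.mono' hF (Eventually.of_forall h)

/-- Shifted Gaussian Fourier transform:
`∫ e^{iLt} K(t - T₀) dt = e^{iLT₀} · 4√π e^{-4L²}`. [folklore] -/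
theorem integral_cexp_mul_gaussK_shift (L T₀ : ℝ) :
    ∫ t : ℝ, cexp ((L : ℂ) * t * I) * (gaussK (t - T₀) : ℂ) =
      cexp ((L : ℂ) * T₀ * I) * ((4 * Real.sqrt π * Real.exp (-(4 * L ^ 2)) : ℝ) : ℂ) := by
  have h := integral_exp_mul_I_mul_gaussian (by norm_num : (0 : ℝ) < 4) L
  have hsub := integral_sub_right_eq_self (μ := (volume : Measure ℝ))
    (fun t : ℝ ↦ cexp ((L : ℂ) * t * I) * (gaussK (t - T₀) : ℂ)) (-T₀)
  simp only [sub_neg_eq_add] at hsub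
  rw [← hsub]
  have : (fun t : ℝ ↦ cexp ((L : ℂ) * ((t + T₀ : ℝ) : ℂ) * I) * (gaussK (t + T₀ - T₀) : ℂ)) =
      fun t : ℝ ↦ cexp ((L : ℂ) * T₀ * I) *
        (cexp ((L : ℂ) * t * I) * (Real.exp (-(4 ^ 2)⁻¹ * t ^ 2) : ℂ)) := by
    funext t
    rw [add_sub_cancel_right, gaussK, ← mul_assoc, ← Complex.exp_add]
    congr 2
    push_cast; ring
  rw [this, integral_const_mul, h]
  congr 2
  ring


/-! ## The Dirichlet-polynomial part `A(t) = ∑_{n<N} n^{-s}` -/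

/-- `n^{-(1/2+it)} = n^{-1/2} · e^{-it log n}` as needed for the Gaussian transform. [folklore] -/
theorem natCast_cpow_neg_half_add (n : ℕ) (hn : n ≠ 0) (t : ℝ) :
    (n : ℂ) ^ (-(1 / 2 + t * I)) =
      (n : ℂ) ^ (-(1 / 2 : ℂ)) * cexp (((-Real.log n : ℝ) : ℂ) * t * I) := by
  rw [neg_add, Complex.cpow_add _ _ (by exact_mod_cast hn), natCast_cpow_neg_mul_I hn]
  congr 2
  push_cast; ring

/-- **The smoothed terms**: `∫ n^{-(1/2+it)} K(t - T₀) dt = n^{-(1/2+iT₀)} · 4√π e^{-4 log² n}`.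
[folklore] -/
theorem integral_natCast_cpow_mul_gaussK {n : ℕ} (hn : n ≠ 0) (T₀ : ℝ) :
    ∫ t : ℝ, (n : ℂ) ^ (-(1 / 2 + t * I)) * (gaussK (t - T₀) : ℂ) =
      (n : ℂ) ^ (-(1 / 2 + T₀ * I)) *
        ((4 * Real.sqrt π * Real.exp (-(4 * Real.log n ^ 2)) : ℝ) : ℂ) := by
  have h : (fun t : ℝ ↦ (n : ℂ) ^ (-(1 / 2 + t * I)) * (gaussK (t - T₀) : ℂ)) = fun t : ℝ ↦
      (n : ℂ) ^ (-(1 / 2 : ℂ)) * (cexp (((-Real.log n : ℝ) : ℂ) * t * I) * (gaussK (t - T₀) : ℂ)) := by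
    funext t; rw [natCast_cpow_neg_half_add n hn t]; ring
  rw [h, integral_const_mul, integral_cexp_mul_gaussK_shift, ← mul_assoc,
    ← natCast_cpow_neg_half_add n hn T₀]
  congr 2
  rw [neg_sq]

/-- Norm of the smoothed `n`-th term: `n^{-1/2} · 4√π e^{-4 log² n}`. [folklore] -/
theorem norm_integral_natCast_cpow_mul_gaussK {n : ℕ} (hn : n ≠ 0) (T₀ : ℝ) :
    ‖∫ t : ℝ, (n : ℂ) ^ (-(1 / 2 + t * I)) * (gaussK (t - T₀) : ℂ)‖ =
      (n : ℝ) ^ (-(1 / 2 : ℝ)) * (4 * Real.sqrt π * Real.exp (-(4 * Real.log n ^ 2))) := by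
  rw [integral_natCast_cpow_mul_gaussK hn, norm_mul, Complex.norm_real, Real.norm_eq_abs,
    abs_of_nonneg (by positivity), Complex.norm_natCast_cpow_of_pos (Nat.pos_of_ne_zero hn)]
  simp

/-- The `n = 1` term is exactly `4√π`. [folklore] -/
theorem integral_one_cpow_mul_gaussK (T₀ : ℝ) :
    ∫ t : ℝ, ((1 : ℕ) : ℂ) ^ (-(1 / 2 + t * I)) * (gaussK (t - T₀) : ℂ) =
      ((4 * Real.sqrt π : ℝ) : ℂ) := by
  rw [integral_natCast_cpow_mul_gaussK one_ne_zero]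
  simp

/-- The key numerical inequality: for `n ≥ 2`, `n^{-1/2} e^{-4 log² n} ≤ ½ n^{-2}`
(uses `log 2 > 5/8`). [folklore] -/
theorem rpow_mul_exp_log_sq_le {x : ℝ} (hx : 2 ≤ x) :
    x ^ (-(1 / 2 : ℝ)) * Real.exp (-(4 * Real.log x ^ 2)) ≤ 1 / 2 * (x ^ 2)⁻¹ := by
  have hx0 : 0 < x := by linarith
  set l := Real.log x with hl
  have ha : (0.6931471803 : ℝ) < Real.log 2 := Real.log_two_gt_d9
  have hla : Real.log 2 ≤ l := Real.log_le_log (by norm_num) hx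
  have h1 : x ^ (-(1 / 2 : ℝ)) * Real.exp (-(4 * l ^ 2)) = Real.exp (-(1 / 2) * l - 4 * l ^ 2) := by
    rw [Real.rpow_def_of_pos hx0, ← Real.exp_add]; congr 1; rw [hl]; ring
  have h2 : 1 / 2 * (x ^ 2)⁻¹ = Real.exp (-Real.log 2 - 2 * l) := by
    rw [sub_eq_add_neg, Real.exp_add, Real.exp_neg, Real.exp_log (by norm_num), hl,
      show -(2 * Real.log x) = Real.log x * (-2 : ℝ) by ring, ← Real.rpow_def_of_pos hx0,
      Real.rpow_neg hx0.le, Real.rpow_two]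
    ring
  rw [h1, h2, Real.exp_le_exp]
  nlinarith [mul_nonneg (sub_nonneg.2 hla) (by linarith : (0 : ℝ) ≤ 4 * Real.log 2 - 3 / 2)]

/-- `∑_{2 ≤ n < N} ½ n^{-2} ≤ ½`. [folklore] -/
theorem sum_Ico_half_inv_sq_le (N : ℕ) :
    ∑ n ∈ Finset.Ico 2 N, (1 / 2 * ((n : ℝ) ^ 2)⁻¹) ≤ 1 / 2 := by
  rw [← Finset.mul_sum]
  have h : Finset.Ico 2 N = Finset.Ioo 1 N := by ext n; simp; omega
  have := sum_Ioo_inv_sq_le (α := ℝ) 1 N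
  rw [h]
  norm_num at this ⊢
  linarith

/-- The Dirichlet polynomial `A_N(t) = ∑_{1 ≤ n < N} n^{-(1/2+it)}` of the Euler–Maclaurin formula.
[cite: Edwards1974, §6.4 eq. (1)] -/
def emSum (N : ℕ) (t : ℝ) : ℂ := ∑ n ∈ Finset.Ico 1 N, (n : ℂ) ^ (-(1 / 2 + t * I))

/-- `t ↦ n^{-(1/2+it)}` is continuous. [folklore] -/
theorem continuous_natCast_cpow_line {n : ℕ} (hn : n ≠ 0) :
    Continuous fun t : ℝ ↦ (n : ℂ) ^ (-(1 / 2 + t * I)) :=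
  continuous_const.cpow (by fun_prop) fun _ ↦
    Or.inl (by exact_mod_cast Nat.pos_of_ne_zero hn)

/-- `‖n^{-(1/2+it)}‖ ≤ 1`. [folklore] -/
theorem norm_natCast_cpow_line_le {n : ℕ} (hn : n ≠ 0) (t : ℝ) :
    ‖(n : ℂ) ^ (-(1 / 2 + t * I))‖ ≤ 1 := by
  rw [Complex.norm_natCast_cpow_of_pos (Nat.pos_of_ne_zero hn)]
  refine Real.rpow_le_one_of_one_le_of_nonpos (by exact_mod_cast Nat.pos_of_ne_zero hn) ?_
  simp

/-- `t ↦ n^{-(1/2+it)} K(t - T₀)` is integrable. [folklore] -/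
theorem integrable_natCast_cpow_mul_gaussK {n : ℕ} (hn : n ≠ 0) (T₀ : ℝ) :
    Integrable fun t : ℝ ↦ (n : ℂ) ^ (-(1 / 2 + t * I)) * (gaussK (t - T₀) : ℂ) := by
  refine integrable_of_norm_le_mul_gaussK (a := 1) (b := 0) (T₀ := T₀)
    (((continuous_natCast_cpow_line hn).mul
      (Complex.continuous_ofReal.comp (continuous_gaussK.comp (continuous_sub_right T₀)))).aestronglyMeasurable)
    fun t ↦ ?_
  rw [norm_mul, Complex.norm_real, Real.norm_eq_abs, abs_of_nonneg (gaussK_pos _).le]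
  have := norm_natCast_cpow_line_le hn t
  have := (gaussK_pos (t - T₀)).le
  nlinarith

/-- **The smoothed Dirichlet polynomial**: `‖∫ A_N(t) K(t-T₀) dt - 4√π‖ ≤ 2√π` (`N ≥ 2`):
the term `n = 1` gives `4√π`, the others at most `4√π ∑_{n≥2} n^{-1/2} e^{-4 log² n} ≤ 2√π`.
[folklore] -/
theorem norm_integral_emSum_sub_le {N : ℕ} (hN : 2 ≤ N) (T₀ : ℝ) :
    ‖(∫ t : ℝ, emSum N t * (gaussK (t - T₀) : ℂ)) - ((4 * Real.sqrt π : ℝ) : ℂ)‖ ≤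
      2 * Real.sqrt π := by
  have hint : ∀ n ∈ Finset.Ico 1 N,
      Integrable fun t : ℝ ↦ (n : ℂ) ^ (-(1 / 2 + t * I)) * (gaussK (t - T₀) : ℂ) :=
    fun n hn ↦ integrable_natCast_cpow_mul_gaussK (by have := (Finset.mem_Ico.1 hn).1; omega) T₀
  have h1 : (∫ t : ℝ, emSum N t * (gaussK (t - T₀) : ℂ)) =
      ∑ n ∈ Finset.Ico 1 N, ∫ t : ℝ, (n : ℂ) ^ (-(1 / 2 + t * I)) * (gaussK (t - T₀) : ℂ) := by
    simp only [emSum, Finset.sum_mul]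
    exact integral_finsetSum _ hint
  rw [h1, Finset.sum_eq_sum_Ico_succ_bot (by omega), integral_one_cpow_mul_gaussK, add_sub_cancel_left]
  calc ‖∑ n ∈ Finset.Ico (1 + 1) N, ∫ t : ℝ, (n : ℂ) ^ (-(1 / 2 + t * I)) * (gaussK (t - T₀) : ℂ)‖
      ≤ ∑ n ∈ Finset.Ico 2 N, ‖∫ t : ℝ, (n : ℂ) ^ (-(1 / 2 + t * I)) * (gaussK (t - T₀) : ℂ)‖ :=
        norm_sum_le _ _
    _ ≤ ∑ n ∈ Finset.Ico 2 N, (4 * Real.sqrt π) * (1 / 2 * ((n : ℝ) ^ 2)⁻¹) := by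
        refine Finset.sum_le_sum fun n hn ↦ ?_
        have hn2 : 2 ≤ n := (Finset.mem_Ico.1 hn).1
        rw [norm_integral_natCast_cpow_mul_gaussK (by omega)]
        have := rpow_mul_exp_log_sq_le (x := n) (by exact_mod_cast hn2)
        have hπ : 0 ≤ 4 * Real.sqrt π := by positivity
        calc (n : ℝ) ^ (-(1 / 2 : ℝ)) * (4 * Real.sqrt π * Real.exp (-(4 * Real.log n ^ 2)))
            = (4 * Real.sqrt π) * ((n : ℝ) ^ (-(1 / 2 : ℝ)) * Real.exp (-(4 * Real.log n ^ 2))) := by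
              ring
          _ ≤ (4 * Real.sqrt π) * (1 / 2 * ((n : ℝ) ^ 2)⁻¹) := by gcongr
    _ = (4 * Real.sqrt π) * ∑ n ∈ Finset.Ico 2 N, (1 / 2 * ((n : ℝ) ^ 2)⁻¹) := by
        rw [Finset.mul_sum]
    _ ≤ (4 * Real.sqrt π) * (1 / 2) := by gcongr; exact sum_Ico_half_inv_sq_le N
    _ = 2 * Real.sqrt π := by ring


/-! ## Absorbing polynomial weights into the Gaussian -/

/-- `(a + b|v| + c v²) e^{-v²/16} ≤ (a + 4b + 32c) e^{-v²/32}` for `a, b, c ≥ 0`. [folklore] -/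
theorem poly_mul_gaussK_le {a b c : ℝ} (ha : 0 ≤ a) (hb : 0 ≤ b) (hc : 0 ≤ c) (v : ℝ) :
    (a + b * |v| + c * v ^ 2) * gaussK v ≤ (a + 4 * b + 32 * c) * Real.exp (-(32 : ℝ)⁻¹ * v ^ 2) := by
  have hE : gaussK v = Real.exp (-(32 : ℝ)⁻¹ * v ^ 2) * Real.exp (-(32 : ℝ)⁻¹ * v ^ 2) := by
    rw [gaussK, ← Real.exp_add]; congr 1; ring
  set E := Real.exp (-(32 : ℝ)⁻¹ * v ^ 2) with hEdef
  have hE0 : 0 < E := Real.exp_pos _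
  have hE1 : E ≤ 1 := by
    rw [hEdef, Real.exp_le_one_iff]; nlinarith [sq_nonneg v]
  -- `E · e^{v²/32} = 1` and `1 + v²/32 ≤ e^{v²/32}`
  have hinv : E * Real.exp ((32 : ℝ)⁻¹ * v ^ 2) = 1 := by
    rw [hEdef, ← Real.exp_add]; simp
  have hexp : 1 + (32 : ℝ)⁻¹ * v ^ 2 ≤ Real.exp ((32 : ℝ)⁻¹ * v ^ 2) := by
    have := Real.add_one_le_exp ((32 : ℝ)⁻¹ * v ^ 2); linarith
  have h1 : v ^ 2 * E ≤ 32 := by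
    have : (1 + (32 : ℝ)⁻¹ * v ^ 2) * E ≤ Real.exp ((32 : ℝ)⁻¹ * v ^ 2) * E := by gcongr
    rw [mul_comm (Real.exp _), hinv] at this
    nlinarith
  have h2 : |v| * E ≤ 4 := by
    have hv : |v| ≤ 4 * (1 + (32 : ℝ)⁻¹ * v ^ 2) := by
      cases' abs_cases v with h h <;> nlinarith [sq_nonneg (v - 4), sq_nonneg (v + 4)]
    have : |v| * E ≤ 4 * (1 + (32 : ℝ)⁻¹ * v ^ 2) * E := by gcongr
    have h' : 4 * (1 + (32 : ℝ)⁻¹ * v ^ 2) * E ≤ 4 * (Real.exp ((32 : ℝ)⁻¹ * v ^ 2) * E) := by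
      rw [mul_assoc]; gcongr
    rw [mul_comm (Real.exp _), hinv] at h'
    linarith
  rw [hE]
  calc (a + b * |v| + c * v ^ 2) * (E * E) = (a * E + b * (|v| * E) + c * (v ^ 2 * E)) * E := by ring
    _ ≤ (a * 1 + b * 4 + c * 32) * E := by gcongr
    _ = (a + 4 * b + 32 * c) * E := by ring

/-- `∫ e^{-v²/32} dv = √(32π) ≤ 11`. [folklore] -/
theorem integral_exp_neg_sq_div_32_le : ∫ v : ℝ, Real.exp (-(32 : ℝ)⁻¹ * v ^ 2) ≤ 11 := by
  rw [integral_gaussian, show π / (32 : ℝ)⁻¹ = 32 * π by field_simp]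
  rw [Real.sqrt_le_left (by norm_num)]
  nlinarith [Real.pi_lt_d2]

/-- **Master bound.** If `‖F(t)‖ ≤ (a + b|t-T₀| + c(t-T₀)²) K(t-T₀)` with `a, b, c ≥ 0` and `F` is
measurable, then `F` is integrable and `‖∫ F‖ ≤ 11 (a + 4b + 32c)`. [folklore] -/
theorem norm_integral_le_of_le_poly_gaussK {E : Type*} [NormedAddCommGroup E] [NormedSpace ℝ E]
    {F : ℝ → E} (hF : AEStronglyMeasurable F volume) {a b c : ℝ} (ha : 0 ≤ a) (hb : 0 ≤ b)
    (hc : 0 ≤ c) (T₀ : ℝ)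
    (h : ∀ t, ‖F t‖ ≤ (a + b * |t - T₀| + c * (t - T₀) ^ 2) * gaussK (t - T₀)) :
    Integrable F ∧ ‖∫ t, F t‖ ≤ 11 * (a + 4 * b + 32 * c) := by
  set G : ℝ → ℝ := fun t ↦ (a + 4 * b + 32 * c) * Real.exp (-(32 : ℝ)⁻¹ * (t - T₀) ^ 2) with hG
  have hGi : Integrable G := by
    have := ((integrable_exp_neg_mul_sq (b := (32 : ℝ)⁻¹) (by norm_num)).const_mul
      (a + 4 * b + 32 * c)).comp_sub_right T₀
    exact this
  have hle : ∀ t, ‖F t‖ ≤ G t := fun t ↦ (h t).trans (poly_mul_gaussK_le ha hb hc (t - T₀))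
  have hFi : Integrable F := hGi.mono' hF (Eventually.of_forall hle)
  refine ⟨hFi, ?_⟩
  calc ‖∫ t, F t‖ ≤ ∫ t, G t := norm_integral_le_of_norm_le hGi (Eventually.of_forall hle)
    _ = (a + 4 * b + 32 * c) * ∫ t, Real.exp (-(32 : ℝ)⁻¹ * (t - T₀) ^ 2) := integral_const_mul _ _
    _ = (a + 4 * b + 32 * c) * ∫ t, Real.exp (-(32 : ℝ)⁻¹ * t ^ 2) := by
        congr 1
        exact integral_sub_right_eq_self (μ := (volume : Measure ℝ))
          (fun t ↦ Real.exp (-(32 : ℝ)⁻¹ * t ^ 2)) T₀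
    _ ≤ (a + 4 * b + 32 * c) * 11 := by gcongr; exact integral_exp_neg_sq_div_32_le
    _ = 11 * (a + 4 * b + 32 * c) := by ring

/-! ## The two boundary terms of the Euler–Maclaurin formula -/

/-- On the critical line `‖s - 1‖ ≥ |t|` and `‖s - 1‖ ≥ 1/2`; hence
`T₀ ≤ (1 + 2|t - T₀|) ‖s - 1‖` for `T₀ ≥ 0`. [folklore] -/
theorem le_mul_norm_sub_one {T₀ : ℝ} (hT₀ : 0 ≤ T₀) (t : ℝ) :
    T₀ ≤ (1 + 2 * |t - T₀|) * ‖(1 / 2 : ℂ) + t * I - 1‖ := by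
  have h1 : |t| ≤ ‖(1 / 2 : ℂ) + t * I - 1‖ := by
    have := abs_im_le_norm ((1 / 2 : ℂ) + t * I - 1)
    simpa using this
  have h2 : 1 / 2 ≤ ‖(1 / 2 : ℂ) + t * I - 1‖ := by
    have := abs_re_le_norm ((1 / 2 : ℂ) + t * I - 1)
    norm_num at this
    exact this
  have h3 : T₀ ≤ |t| + |t - T₀| := by
    have := abs_sub t (t - T₀)
    rwa [sub_sub_cancel, abs_of_nonneg hT₀] at this
  nlinarith [abs_nonneg (t - T₀)]

/-- The boundary term `B_N(t) = N^{1-s}/(s-1)`, `s = 1/2 + it`. [cite: Edwards1974, §6.4 eq. (1)] -/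
def emBdry (N : ℕ) (t : ℝ) : ℂ := (N : ℂ) ^ (1 - (1 / 2 + t * I)) / (1 / 2 + t * I - 1)

/-- `B_N` is continuous in `t`. [folklore] -/
theorem continuous_emBdry {N : ℕ} (hN : N ≠ 0) : Continuous (emBdry N) := by
  unfold emBdry
  refine Continuous.div ?_ (by fun_prop) fun t ↦ sub_ne_zero.2 (one_half_add_ne_one t)
  exact continuous_const.cpow (by fun_prop) fun _ ↦
    Or.inl (by exact_mod_cast Nat.pos_of_ne_zero hN)

/-- `‖B_N(t)‖ ≤ (√N/T₀)(1 + 2|t - T₀|)` for `T₀ > 0`. [folklore] -/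
theorem norm_emBdry_le {N : ℕ} (hN : N ≠ 0) {T₀ : ℝ} (hT₀ : 0 < T₀) (t : ℝ) :
    ‖emBdry N t‖ ≤ Real.sqrt N / T₀ * (1 + 2 * |t - T₀|) := by
  have hkey := le_mul_norm_sub_one hT₀.le t
  have hpos : 0 < ‖(1 / 2 : ℂ) + t * I - 1‖ := norm_pos_iff.2 (sub_ne_zero.2 (one_half_add_ne_one t))
  unfold emBdry
  rw [norm_div, Complex.norm_natCast_cpow_of_pos (Nat.pos_of_ne_zero hN)]
  have hre : (1 - (1 / 2 + (t : ℂ) * I)).re = 1 / 2 := by simp; norm_num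
  rw [hre, ← Real.sqrt_eq_rpow, div_le_iff₀ hpos]
  calc Real.sqrt N = Real.sqrt N / T₀ * T₀ := by field_simp
    _ ≤ Real.sqrt N / T₀ * ((1 + 2 * |t - T₀|) * ‖(1 / 2 : ℂ) + t * I - 1‖) := by gcongr
    _ = Real.sqrt N / T₀ * (1 + 2 * |t - T₀|) * ‖(1 / 2 : ℂ) + t * I - 1‖ := by ring

/-- `‖∫ B_N(t) K(t-T₀) dt‖ ≤ 99 √N / T₀`. [folklore] -/
theorem norm_integral_emBdry_le {N : ℕ} (hN : N ≠ 0) {T₀ : ℝ} (hT₀ : 0 < T₀) :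
    (Integrable fun t : ℝ ↦ emBdry N t * (gaussK (t - T₀) : ℂ)) ∧
    ‖∫ t : ℝ, emBdry N t * (gaussK (t - T₀) : ℂ)‖ ≤ 99 * (Real.sqrt N / T₀) := by
  have h := norm_integral_le_of_le_poly_gaussK (F := fun t : ℝ ↦ emBdry N t * (gaussK (t - T₀) : ℂ))
    (((continuous_emBdry hN).mul (Complex.continuous_ofReal.comp
      (continuous_gaussK.comp (continuous_sub_right T₀)))).aestronglyMeasurable)
    (a := Real.sqrt N / T₀) (b := 2 * (Real.sqrt N / T₀)) (c := 0) (by positivity) (by positivity)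
    le_rfl T₀ fun t ↦ ?_
  · refine ⟨h.1, h.2.trans (by ring_nf; rfl)⟩
  · rw [norm_mul, Complex.norm_real, Real.norm_eq_abs, abs_of_nonneg (gaussK_pos _).le]
    have := norm_emBdry_le hN hT₀ t
    have := (gaussK_pos (t - T₀)).le
    calc ‖emBdry N t‖ * gaussK (t - T₀) ≤ Real.sqrt N / T₀ * (1 + 2 * |t - T₀|) * gaussK (t - T₀) := by
          gcongr
      _ = (Real.sqrt N / T₀ + 2 * (Real.sqrt N / T₀) * |t - T₀| + 0 * (t - T₀) ^ 2) * gaussK (t - T₀) := by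
          ring

/-- The term `C_N(t) = N^{-s}/2`. [cite: Edwards1974, §6.4 eq. (1)] -/
def emHalf (N : ℕ) (t : ℝ) : ℂ := (N : ℂ) ^ (-(1 / 2 + t * I)) / 2

/-- `‖∫ C_N(t) K(t-T₀) dt‖ ≤ 6/√N`. [folklore] -/
theorem norm_integral_emHalf_le {N : ℕ} (hN : N ≠ 0) (T₀ : ℝ) :
    (Integrable fun t : ℝ ↦ emHalf N t * (gaussK (t - T₀) : ℂ)) ∧
    ‖∫ t : ℝ, emHalf N t * (gaussK (t - T₀) : ℂ)‖ ≤ 6 * (N : ℝ) ^ (-(1 / 2 : ℝ)) := by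
  have h := norm_integral_le_of_le_poly_gaussK (F := fun t : ℝ ↦ emHalf N t * (gaussK (t - T₀) : ℂ))
    ((((continuous_natCast_cpow_line hN).div_const 2).mul (Complex.continuous_ofReal.comp
      (continuous_gaussK.comp (continuous_sub_right T₀)))).aestronglyMeasurable)
    (a := (N : ℝ) ^ (-(1 / 2 : ℝ)) / 2) (b := 0) (c := 0) (by positivity) le_rfl le_rfl T₀ fun t ↦ ?_
  · refine ⟨h.1, h.2.trans (by ring_nf; linarith [Real.rpow_nonneg (Nat.cast_nonneg N) (-(1 / 2 : ℝ))])⟩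
  · rw [norm_mul, Complex.norm_real, Real.norm_eq_abs, abs_of_nonneg (gaussK_pos _).le, emHalf,
      norm_div, Complex.norm_natCast_cpow_of_pos (Nat.pos_of_ne_zero hN)]
    simp


/-! ## Fourier transforms of `K` and `v K(v)` -/

/-- `Φ₀(ξ) = ∫ e^{iξv} K(v) dv = 4√π e^{-4ξ²}`. [folklore] -/
theorem integral_cexp_mul_gaussK (ξ : ℝ) :
    ∫ v : ℝ, cexp ((ξ : ℂ) * v * I) * (gaussK v : ℂ) =
      ((4 * Real.sqrt π * Real.exp (-(4 * ξ ^ 2)) : ℝ) : ℂ) := by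
  have := integral_cexp_mul_gaussK_shift ξ 0
  simp only [sub_zero, Complex.ofReal_zero, mul_zero, zero_mul, Complex.exp_zero, one_mul] at this
  exact this

/-- `K'(v) = -(v/8) K(v)`. [folklore] -/
theorem hasDerivAt_gaussK (v : ℝ) : HasDerivAt gaussK (-(8 : ℝ)⁻¹ * v * gaussK v) v := by
  have h := ((hasDerivAt_pow 2 v).const_mul (-(4 ^ 2 : ℝ)⁻¹)).exp
  have e : (fun x : ℝ ↦ Real.exp (-(4 ^ 2 : ℝ)⁻¹ * x ^ 2)) = gaussK := rfl
  rw [e] at h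
  convert h using 1
  simp only [gaussK, Nat.cast_ofNat, Nat.add_one_sub_one, pow_one]
  ring

/-- `(e^{iξv} K(v))' = (iξ - v/8) e^{iξv} K(v)`. [folklore] -/
theorem hasDerivAt_cexp_mul_gaussK (ξ v : ℝ) :
    HasDerivAt (fun v : ℝ ↦ cexp ((ξ : ℂ) * v * I) * (gaussK v : ℂ))
      ((ξ : ℂ) * I * (cexp ((ξ : ℂ) * v * I) * (gaussK v : ℂ)) -
        (8 : ℂ)⁻¹ * ((v : ℂ) * (cexp ((ξ : ℂ) * v * I) * (gaussK v : ℂ)))) v := by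
  have h1 : HasDerivAt (fun v : ℝ ↦ cexp ((ξ : ℂ) * v * I)) (cexp ((ξ : ℂ) * v * I) * ((ξ : ℂ) * 1 * I)) v := by
    have h0 : HasDerivAt (fun v : ℝ ↦ (ξ : ℂ) * v * I) ((ξ : ℂ) * 1 * I) v :=
      ((hasDerivAt_id (v : ℂ)).comp_ofReal.const_mul (ξ : ℂ)).mul_const I |>.congr_deriv (by simp)
    exact h0.cexp
  have h2 : HasDerivAt (fun v : ℝ ↦ (gaussK v : ℂ)) (((-(8 : ℝ)⁻¹ * v * gaussK v : ℝ) : ℂ)) v :=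
    (hasDerivAt_gaussK v).ofReal_comp
  exact (h1.mul h2).congr_deriv (by push_cast; ring)

/-- `e^{iξv} K(v)` is integrable. [folklore] -/
theorem integrable_cexp_mul_gaussK (ξ : ℝ) :
    Integrable fun v : ℝ ↦ cexp ((ξ : ℂ) * v * I) * (gaussK v : ℂ) := by
  refine integrable_of_norm_le_mul_gaussK (a := 1) (b := 0) (T₀ := 0)
    (by fun_prop : Continuous fun v : ℝ ↦ cexp ((ξ : ℂ) * v * I) * (gaussK v : ℂ)).aestronglyMeasurable
    fun v ↦ ?_
  rw [norm_mul, norm_cexp_mul_mul_I ξ v, Complex.norm_real, Real.norm_eq_abs,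
    abs_of_nonneg (gaussK_pos _).le]
  simp

/-- `v e^{iξv} K(v)` is integrable. [folklore] -/
theorem integrable_mul_cexp_mul_gaussK (ξ : ℝ) :
    Integrable fun v : ℝ ↦ (v : ℂ) * (cexp ((ξ : ℂ) * v * I) * (gaussK v : ℂ)) := by
  have h := norm_integral_le_of_le_poly_gaussK
    (F := fun v : ℝ ↦ (v : ℂ) * (cexp ((ξ : ℂ) * v * I) * (gaussK v : ℂ)))
    (by fun_prop : Continuous fun v : ℝ ↦
      (v : ℂ) * (cexp ((ξ : ℂ) * v * I) * (gaussK v : ℂ))).aestronglyMeasurable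
    (a := 0) (b := 1) (c := 0) le_rfl zero_le_one le_rfl 0 fun v ↦ ?_
  · exact h.1
  · rw [norm_mul, norm_mul, norm_cexp_mul_mul_I ξ v, Complex.norm_real, Complex.norm_real,
      Real.norm_eq_abs, Real.norm_eq_abs, abs_of_nonneg (gaussK_pos _).le]
    simp

/-- `Φ₁(ξ) = ∫ v e^{iξv} K(v) dv = 8iξ Φ₀(ξ)` (integrate `(e^{iξv}K(v))' = (iξ - v/8) e^{iξv}K(v)`
over `ℝ`). [folklore] -/
theorem integral_mul_cexp_mul_gaussK (ξ : ℝ) :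
    ∫ v : ℝ, (v : ℂ) * (cexp ((ξ : ℂ) * v * I) * (gaussK v : ℂ)) =
      8 * ((ξ : ℂ) * I) * ((4 * Real.sqrt π * Real.exp (-(4 * ξ ^ 2)) : ℝ) : ℂ) := by
  have hf := integrable_cexp_mul_gaussK ξ
  have hg := integrable_mul_cexp_mul_gaussK ξ
  have h0 := integral_eq_zero_of_hasDerivAt_of_integrable (hasDerivAt_cexp_mul_gaussK ξ)
    ((hf.const_mul ((ξ : ℂ) * I)).sub (hg.const_mul (8 : ℂ)⁻¹)) hf
  rw [integral_sub (hf.const_mul _) (hg.const_mul _), integral_const_mul, integral_const_mul,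
    integral_cexp_mul_gaussK, sub_eq_zero] at h0
  have h8 : (8 : ℂ) ≠ 0 := by norm_num
  calc ∫ v : ℝ, (v : ℂ) * (cexp ((ξ : ℂ) * v * I) * (gaussK v : ℂ))
      = 8 * ((8 : ℂ)⁻¹ * ∫ v : ℝ, (v : ℂ) * (cexp ((ξ : ℂ) * v * I) * (gaussK v : ℂ))) := by
        rw [← mul_assoc, mul_inv_cancel₀ h8, one_mul]
    _ = 8 * ((ξ : ℂ) * I) * ((4 * Real.sqrt π * Real.exp (-(4 * ξ ^ 2)) : ℝ) : ℂ) := by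
        rw [← h0]; ring

/-- **The weighted transform** `∫ (1/2 + it) e^{iξt} K(t - T₀) dt = e^{iξT₀} Φ₀(ξ) (1/2 - 8ξ + iT₀)`.
[folklore] -/
theorem integral_line_mul_cexp_mul_gaussK (ξ T₀ : ℝ) :
    ∫ t : ℝ, (1 / 2 + t * I) * cexp ((ξ : ℂ) * t * I) * (gaussK (t - T₀) : ℂ) =
      cexp ((ξ : ℂ) * T₀ * I) * ((4 * Real.sqrt π * Real.exp (-(4 * ξ ^ 2)) : ℝ) : ℂ) *
        (1 / 2 - 8 * ξ + T₀ * I) := by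
  have hsub := integral_sub_right_eq_self (μ := (volume : Measure ℝ))
    (fun t : ℝ ↦ (1 / 2 + t * I) * cexp ((ξ : ℂ) * t * I) * (gaussK (t - T₀) : ℂ)) (-T₀)
  simp only [sub_neg_eq_add] at hsub
  rw [← hsub]
  have hf := integrable_cexp_mul_gaussK ξ
  have hg := integrable_mul_cexp_mul_gaussK ξ
  have h : (fun t : ℝ ↦ (1 / 2 + ((t + T₀ : ℝ) : ℂ) * I) * cexp ((ξ : ℂ) * ((t + T₀ : ℝ) : ℂ) * I) *
      (gaussK (t + T₀ - T₀) : ℂ)) = fun t : ℝ ↦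
      cexp ((ξ : ℂ) * T₀ * I) * (1 / 2 + T₀ * I) * (cexp ((ξ : ℂ) * t * I) * (gaussK t : ℂ)) +
      cexp ((ξ : ℂ) * T₀ * I) * I * ((t : ℂ) * (cexp ((ξ : ℂ) * t * I) * (gaussK t : ℂ))) := by
    funext t
    rw [add_sub_cancel_right]
    have : cexp ((ξ : ℂ) * ((t + T₀ : ℝ) : ℂ) * I) = cexp ((ξ : ℂ) * T₀ * I) * cexp ((ξ : ℂ) * t * I) := by
      rw [← Complex.exp_add]; congr 1; push_cast; ring
    rw [this]; push_cast; ring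
  rw [h, integral_add ((hf.const_mul _)) (hg.const_mul _), integral_const_mul, integral_const_mul,
    integral_cexp_mul_gaussK, integral_mul_cexp_mul_gaussK]
  have hI : I * I = -1 := Complex.I_mul_I
  linear_combination (8 * ξ * cexp ((ξ : ℂ) * T₀ * I) *
    ((4 * Real.sqrt π * Real.exp (-(4 * ξ ^ 2)) : ℝ) : ℂ)) * hI

/-- Norm form: `‖∫ (1/2 + it) e^{iξt} K(t - T₀) dt‖ ≤ 4√π e^{-4ξ²} (1/2 + 8|ξ| + |T₀|)`. [folklore] -/
theorem norm_integral_line_mul_cexp_mul_gaussK_le (ξ T₀ : ℝ) :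
    ‖∫ t : ℝ, (1 / 2 + t * I) * cexp ((ξ : ℂ) * t * I) * (gaussK (t - T₀) : ℂ)‖ ≤
      4 * Real.sqrt π * Real.exp (-(4 * ξ ^ 2)) * (1 / 2 + 8 * |ξ| + |T₀|) := by
  rw [integral_line_mul_cexp_mul_gaussK, norm_mul, norm_mul, norm_cexp_mul_mul_I ξ T₀,
    one_mul, Complex.norm_real, Real.norm_eq_abs, abs_of_nonneg (by positivity)]
  gcongr
  calc ‖(1 / 2 : ℂ) - 8 * ξ + T₀ * I‖ ≤ ‖(1 / 2 : ℂ)‖ + ‖(8 : ℂ) * ξ‖ + ‖(T₀ : ℂ) * I‖ := by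
        refine (norm_add_le _ _).trans ?_
        gcongr
        exact norm_sub_le _ _
    _ = 1 / 2 + 8 * |ξ| + |T₀| := by simp


/-! ## The remainder term `D_N(t) = s ∫_N^∞ B̄₁(x) x^{-s-1} dx` -/

/-- The Euler–Maclaurin remainder `D_N(t) = s ∫_N^∞ B̄₁(x) x^{-(s+1)} dx`, `s = 1/2 + it`.
[cite: Edwards1974, §6.4 eq. (1)] -/
def emTail (N : ℕ) (t : ℝ) : ℂ := (1 / 2 + t * I) * bernoulliIntegral 1 N (1 / 2 + t * I)

/-- The double integrand `s B̄₁(x) x^{-(s+1)} K(t - T₀)` on `ℝ × (N, ∞)`. [folklore] -/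
def tailIntegrand (T₀ : ℝ) (t x : ℝ) : ℂ :=
  (1 / 2 + t * I) * ((bernoulliPer 1 x : ℂ) * (x : ℂ) ^ (-((1 / 2 + t * I) + 1))) *
    (gaussK (t - T₀) : ℂ)

/-- The `x`-integral of the double integrand is `D_N(t) K(t - T₀)`. [folklore] -/
theorem integral_tailIntegrand_right (N : ℕ) (T₀ t : ℝ) :
    ∫ x in Ioi (N : ℝ), tailIntegrand T₀ t x = emTail N t * (gaussK (t - T₀) : ℂ) := by
  unfold tailIntegrand emTail bernoulliIntegral
  rw [integral_mul_const, integral_const_mul]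
  push_cast
  ring

/-- For real `x > 0`: `x^{-(s+1)} = x^{-3/2} e^{-it log x}`, `s = 1/2 + it`. [folklore] -/
theorem ofReal_cpow_neg_line_add_one {x : ℝ} (hx : 0 < x) (t : ℝ) :
    (x : ℂ) ^ (-((1 / 2 + t * I) + 1)) =
      (x : ℂ) ^ (-(3 / 2 : ℂ)) * cexp (((-Real.log x : ℝ) : ℂ) * t * I) := by
  have hx0 : (x : ℂ) ≠ 0 := by exact_mod_cast hx.ne'
  rw [show -((1 / 2 + (t : ℂ) * I) + 1) = -(3 / 2 : ℂ) + -(t * I) by ring, Complex.cpow_add _ _ hx0,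
    Complex.cpow_def_of_ne_zero hx0 (-(t * I)), ← Complex.ofReal_log hx.le]
  congr 2
  push_cast; ring

/-- The `t`-integral of the double integrand, bounded:
`‖∫ s B̄₁(x) x^{-(s+1)} K(t-T₀) dt‖ ≤ ½ x^{-3/2} · 4√π e^{-4 log² x} (1/2 + 8|log x| + |T₀|)`.
[folklore] -/
theorem norm_integral_tailIntegrand_left_le {x : ℝ} (hx : 0 < x) (T₀ : ℝ) :
    ‖∫ t : ℝ, tailIntegrand T₀ t x‖ ≤ 1 / 2 * x ^ (-(3 / 2 : ℝ)) *
      (4 * Real.sqrt π * Real.exp (-(4 * Real.log x ^ 2)) * (1 / 2 + 8 * |Real.log x| + |T₀|)) := by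
  have h : (fun t : ℝ ↦ tailIntegrand T₀ t x) = fun t : ℝ ↦
      ((bernoulliPer 1 x : ℂ) * (x : ℂ) ^ (-(3 / 2 : ℂ))) *
        ((1 / 2 + t * I) * cexp (((-Real.log x : ℝ) : ℂ) * t * I) * (gaussK (t - T₀) : ℂ)) := by
    funext t
    rw [tailIntegrand, ofReal_cpow_neg_line_add_one hx]
    ring
  rw [h, integral_const_mul, norm_mul, norm_mul, Complex.norm_real, Real.norm_eq_abs,
    Complex.norm_cpow_eq_rpow_re_of_pos hx]
  have hre : (-(3 / 2 : ℂ)).re = -(3 / 2 : ℝ) := by simp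
  rw [hre]
  have h1 := abs_bernoulliPer_one_le x
  have h2 := norm_integral_line_mul_cexp_mul_gaussK_le (-Real.log x) T₀
  rw [abs_neg, neg_sq] at h2
  have h3 : 0 ≤ x ^ (-(3 / 2 : ℝ)) := Real.rpow_nonneg hx.le _
  calc |bernoulliPer 1 x| * x ^ (-(3 / 2 : ℝ)) *
        ‖∫ t : ℝ, (1 / 2 + t * I) * cexp (((-Real.log x : ℝ) : ℂ) * t * I) * (gaussK (t - T₀) : ℂ)‖
      ≤ 1 / 2 * x ^ (-(3 / 2 : ℝ)) *
        (4 * Real.sqrt π * Real.exp (-(4 * Real.log x ^ 2)) * (1 / 2 + 8 * |Real.log x| + |T₀|)) := by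
        gcongr

/-- Elementary: for `x ≥ 3`, `½ x^{-3/2} · 4√π e^{-4 log² x}(1/2 + 8 log x + |T₀|) ≤ 2√π (9 + |T₀|) x^{-9/2}`
(`log x ≥ 1`, so `e^{-4 log² x} ≤ x^{-4}`, and `log x ≤ x`). [folklore] -/
theorem tail_majorant_le {x : ℝ} (hx : 3 ≤ x) (T₀ : ℝ) :
    1 / 2 * x ^ (-(3 / 2 : ℝ)) *
      (4 * Real.sqrt π * Real.exp (-(4 * Real.log x ^ 2)) * (1 / 2 + 8 * |Real.log x| + |T₀|)) ≤
      2 * Real.sqrt π * (9 + |T₀|) * x ^ (-(9 / 2 : ℝ)) := by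
  have hx0 : 0 < x := by linarith
  have hlog1 : 1 ≤ Real.log x := by
    rw [Real.le_log_iff_exp_le hx0]
    have := Real.exp_one_lt_d9; linarith
  have hlog0 : 0 ≤ Real.log x := by linarith
  have hexp : Real.exp (-(4 * Real.log x ^ 2)) ≤ x ^ (-(4 : ℝ)) := by
    rw [Real.rpow_def_of_pos hx0, Real.exp_le_exp]
    nlinarith
  have hlogx : |Real.log x| ≤ x := by
    rw [abs_of_nonneg hlog0]
    linarith [Real.log_le_sub_one_of_pos hx0]
  have hpoly : 1 / 2 + 8 * |Real.log x| + |T₀| ≤ (9 + |T₀|) * x := by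
    nlinarith [abs_nonneg T₀]
  have hpow : x ^ (-(3 / 2 : ℝ)) * x ^ (-(4 : ℝ)) * x = x ^ (-(9 / 2 : ℝ)) := by
    rw [← Real.rpow_add hx0, ← Real.rpow_add_one hx0.ne']; norm_num
  calc 1 / 2 * x ^ (-(3 / 2 : ℝ)) *
        (4 * Real.sqrt π * Real.exp (-(4 * Real.log x ^ 2)) * (1 / 2 + 8 * |Real.log x| + |T₀|))
      ≤ 1 / 2 * x ^ (-(3 / 2 : ℝ)) * (4 * Real.sqrt π * x ^ (-(4 : ℝ)) * ((9 + |T₀|) * x)) := by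
        gcongr
    _ = 2 * Real.sqrt π * (9 + |T₀|) * (x ^ (-(3 / 2 : ℝ)) * x ^ (-(4 : ℝ)) * x) := by ring
    _ = 2 * Real.sqrt π * (9 + |T₀|) * x ^ (-(9 / 2 : ℝ)) := by rw [hpow]

/-- The double integrand is measurable. [folklore] -/
theorem measurable_tailIntegrand (T₀ : ℝ) : Measurable (Function.uncurry (tailIntegrand T₀)) := by
  unfold tailIntegrand Function.uncurry
  refine Measurable.mul (Measurable.mul (by fun_prop) (Measurable.mul ?_ ?_)) ?_
  · exact Complex.measurable_ofReal.comp ((measurable_bernoulliPer 1).comp measurable_snd)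
  · exact (Complex.measurable_ofReal.comp measurable_snd).pow (by fun_prop)
  · exact Complex.measurable_ofReal.comp (continuous_gaussK.measurable.comp (measurable_fst.sub_const T₀))

/-- Almost every point of `ℝ × (N, ∞)` has second coordinate `> N`. [folklore] -/
theorem ae_snd_mem_Ioi (N : ℝ) :
    ∀ᵐ p : ℝ × ℝ ∂((volume : Measure ℝ).prod (volume.restrict (Ioi N))), p.2 ∈ Ioi N := by
  have : (volume : Measure ℝ).prod (volume.restrict (Ioi N)) =
      ((volume : Measure ℝ).prod volume).restrict (univ ×ˢ Ioi N) := by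
    rw [← Measure.prod_restrict, Measure.restrict_univ]
  rw [this]
  filter_upwards [ae_restrict_mem (MeasurableSet.univ.prod measurableSet_Ioi)] with p hp
  exact hp.2

/-- `t ↦ ‖s‖ K(t - T₀)` is integrable. [folklore] -/
theorem integrable_norm_line_mul_gaussK (T₀ : ℝ) :
    Integrable fun t : ℝ ↦ ‖(1 / 2 : ℂ) + t * I‖ * gaussK (t - T₀) := by
  refine (norm_integral_le_of_le_poly_gaussK (F := fun t : ℝ ↦ ‖(1 / 2 : ℂ) + t * I‖ * gaussK (t - T₀))
    ((by fun_prop : Continuous fun t : ℝ ↦ ‖(1 / 2 : ℂ) + t * I‖ * gaussK (t - T₀))).aestronglyMeasurable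
    (a := 1 / 2 + |T₀|) (b := 1) (c := 0) (by positivity) zero_le_one le_rfl T₀ fun t ↦ ?_).1
  rw [Real.norm_eq_abs, abs_of_nonneg (mul_nonneg (norm_nonneg _) (gaussK_pos _).le)]
  gcongr
  · exact (gaussK_pos _).le
  · calc ‖(1 / 2 : ℂ) + t * I‖ ≤ ‖(1 / 2 : ℂ)‖ + ‖(t : ℂ) * I‖ := norm_add_le _ _
      _ = 1 / 2 + |t| := by simp
      _ ≤ 1 / 2 + (|T₀| + |t - T₀|) := by
          gcongr
          have := abs_add_le T₀ (t - T₀); rwa [add_sub_cancel] at this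
      _ = 1 / 2 + |T₀| + 1 * |t - T₀| + 0 * (t - T₀) ^ 2 := by ring

/-- The double integrand is integrable on `ℝ × (N, ∞)` (`N ≥ 1`). [folklore] -/
theorem integrable_tailIntegrand {N : ℕ} (hN : 1 ≤ N) (T₀ : ℝ) :
    Integrable (Function.uncurry (tailIntegrand T₀))
      ((volume : Measure ℝ).prod (volume.restrict (Ioi (N : ℝ)))) := by
  have hN0 : (0 : ℝ) < N := by exact_mod_cast hN
  have hg : Integrable (fun x : ℝ ↦ 1 / 2 * x ^ (-(3 / 2 : ℝ))) (volume.restrict (Ioi (N : ℝ))) :=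
    ((integrableOn_Ioi_rpow_of_lt (by norm_num) hN0).const_mul (1 / 2))
  have hF := (integrable_norm_line_mul_gaussK T₀).mul_prod hg
  refine hF.mono' (measurable_tailIntegrand T₀).aestronglyMeasurable ?_
  filter_upwards [ae_snd_mem_Ioi (N : ℝ)] with p hp
  have hx : 0 < p.2 := hN0.trans hp
  simp only [Function.uncurry, tailIntegrand]
  rw [norm_mul, norm_mul, norm_mul, Complex.norm_real, Complex.norm_real, Real.norm_eq_abs,
    Real.norm_eq_abs, abs_of_nonneg (gaussK_pos _).le, Complex.norm_cpow_eq_rpow_re_of_pos hx]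
  have hre : (-((1 / 2 + (p.1 : ℂ) * I) + 1)).re = -(3 / 2 : ℝ) := by simp; norm_num
  rw [hre]
  have h1 := abs_bernoulliPer_one_le p.2
  have h3 : 0 ≤ p.2 ^ (-(3 / 2 : ℝ)) := Real.rpow_nonneg hx.le _
  have h4 := (gaussK_pos (p.1 - T₀)).le
  have h5 := norm_nonneg ((1 / 2 : ℂ) + p.1 * I)
  calc ‖(1 / 2 : ℂ) + p.1 * I‖ * (|bernoulliPer 1 p.2| * p.2 ^ (-(3 / 2 : ℝ))) * gaussK (p.1 - T₀)
      ≤ ‖(1 / 2 : ℂ) + p.1 * I‖ * (1 / 2 * p.2 ^ (-(3 / 2 : ℝ))) * gaussK (p.1 - T₀) := by gcongr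
    _ = ‖(1 / 2 : ℂ) + p.1 * I‖ * gaussK (p.1 - T₀) * (1 / 2 * p.2 ^ (-(3 / 2 : ℝ))) := by ring

/-- **The smoothed remainder is negligible**: for `N ≥ 3`,
`‖∫ D_N(t) K(t - T₀) dt‖ ≤ (4√π/7) (9 + |T₀|) N^{-7/2}` (Fubini, the weighted Gaussian transform at
frequency `log x ≥ log N`, and `∫_N^∞ x^{-9/2} dx = (2/7) N^{-7/2}`). [folklore] -/
theorem norm_integral_emTail_le {N : ℕ} (hN : 3 ≤ N) (T₀ : ℝ) :
    (Integrable fun t : ℝ ↦ emTail N t * (gaussK (t - T₀) : ℂ)) ∧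
    ‖∫ t : ℝ, emTail N t * (gaussK (t - T₀) : ℂ)‖ ≤
      4 * Real.sqrt π / 7 * (9 + |T₀|) * (N : ℝ) ^ (-(7 / 2 : ℝ)) := by
  have hN1 : 1 ≤ N := by omega
  have hN0 : (0 : ℝ) < N := by exact_mod_cast (show 0 < N by omega)
  have hN3 : (3 : ℝ) ≤ N := by exact_mod_cast hN
  have hI := integrable_tailIntegrand hN1 T₀
  have heq : (fun t : ℝ ↦ emTail N t * (gaussK (t - T₀) : ℂ)) =
      fun t : ℝ ↦ ∫ x in Ioi (N : ℝ), tailIntegrand T₀ t x := by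
    funext t; exact (integral_tailIntegrand_right N T₀ t).symm
  rw [heq]
  refine ⟨hI.integral_prod_left, ?_⟩
  rw [integral_integral_swap hI]
  have hmaj : Integrable (fun x : ℝ ↦ 2 * Real.sqrt π * (9 + |T₀|) * x ^ (-(9 / 2 : ℝ)))
      (volume.restrict (Ioi (N : ℝ))) :=
    (integrableOn_Ioi_rpow_of_lt (by norm_num) hN0).const_mul _
  calc ‖∫ x in Ioi (N : ℝ), ∫ t : ℝ, tailIntegrand T₀ t x‖
      ≤ ∫ x in Ioi (N : ℝ), 2 * Real.sqrt π * (9 + |T₀|) * x ^ (-(9 / 2 : ℝ)) := by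
        refine norm_integral_le_of_norm_le hmaj ?_
        filter_upwards [ae_restrict_mem measurableSet_Ioi] with x hx
        have hx3 : 3 ≤ x := hN3.trans (le_of_lt hx)
        exact (norm_integral_tailIntegrand_left_le (by linarith) T₀).trans (tail_majorant_le hx3 T₀)
    _ = 2 * Real.sqrt π * (9 + |T₀|) * (-(N : ℝ) ^ (-(9 / 2 : ℝ) + 1) / (-(9 / 2 : ℝ) + 1)) := by
        rw [integral_const_mul, integral_Ioi_rpow_of_lt (by norm_num) hN0]
    _ = 4 * Real.sqrt π / 7 * (9 + |T₀|) * (N : ℝ) ^ (-(7 / 2 : ℝ)) := by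
        norm_num; ring


/-! ## Assembly: the smoothed first moment `L(T₀) = ∫ ζ(1/2+it) K(t-T₀) dt` -/

/-- **Euler–Maclaurin on the critical line**: `ζ(1/2+it) = A_N(t) + B_N(t) + C_N(t) - D_N(t)`
(`N ≥ 1`). [cite: Edwards1974, §6.4 eq. (1)] -/
theorem riemannZeta_line_eq_em {N : ℕ} (hN : 1 ≤ N) (t : ℝ) :
    riemannZeta (1 / 2 + t * I) = emSum N t + emBdry N t + emHalf N t - emTail N t := by
  have h := riemannZeta_eq_eulerMaclaurin₀ hN (s := 1 / 2 + t * I) (by simp) (one_half_add_ne_one t)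
  rw [h]
  rfl

/-- `‖ζ(1/2 + it)‖ ≤ 2 + 2|t|` (Titchmarsh (2.12.2) with `‖s - 1‖ = ‖s‖` on the critical line).
[cite: Titchmarsh1986, §2.12 eq. (2.12.2)] -/
theorem norm_riemannZeta_line_le (t : ℝ) : ‖riemannZeta (1 / 2 + t * I)‖ ≤ 2 + 2 * |t| := by
  have h := norm_riemannZeta_le_of_re_pos (s := 1 / 2 + t * I) (by simp) (one_half_add_ne_one t)
  rw [norm_one_half_add_sub_one, div_self (norm_one_half_add_pos t).ne'] at h
  have hre : ((1 / 2 : ℂ) + t * I).re = 1 / 2 := by simp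
  rw [hre] at h
  have hs : ‖(1 / 2 : ℂ) + t * I‖ ≤ 1 / 2 + |t| := by
    calc ‖(1 / 2 : ℂ) + t * I‖ ≤ ‖(1 / 2 : ℂ)‖ + ‖(t : ℂ) * I‖ := norm_add_le _ _
      _ = 1 / 2 + |t| := by simp
  calc ‖riemannZeta (1 / 2 + t * I)‖ ≤ 1 + ‖(1 / 2 : ℂ) + t * I‖ / (1 / 2) := h
    _ = 1 + 2 * ‖(1 / 2 : ℂ) + t * I‖ := by ring
    _ ≤ 1 + 2 * (1 / 2 + |t|) := by gcongr
    _ = 2 + 2 * |t| := by ring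

/-- `‖ζ(1/2 + it)‖ ≤ 2 + 2|T₀| + 2|t - T₀|`. [folklore] -/
theorem norm_riemannZeta_line_le' (T₀ t : ℝ) :
    ‖riemannZeta (1 / 2 + t * I)‖ ≤ 2 + 2 * |T₀| + 2 * |t - T₀| := by
  have h := norm_riemannZeta_line_le t
  have : |t| ≤ |T₀| + |t - T₀| := by
    have := abs_add_le T₀ (t - T₀); rwa [add_sub_cancel] at this
  linarith

/-- `t ↦ ζ(1/2+it) K(t - T₀)` is integrable and `‖∫ ζ K‖ ≤ ∫ ‖ζ‖ K`. [folklore] -/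
theorem integrable_riemannZeta_mul_gaussK (T₀ : ℝ) :
    Integrable fun t : ℝ ↦ riemannZeta (1 / 2 + t * I) * (gaussK (t - T₀) : ℂ) := by
  refine (norm_integral_le_of_le_poly_gaussK
    (F := fun t : ℝ ↦ riemannZeta (1 / 2 + t * I) * (gaussK (t - T₀) : ℂ))
    ((continuous_riemannZeta_line.mul (Complex.continuous_ofReal.comp
      (continuous_gaussK.comp (continuous_sub_right T₀)))).aestronglyMeasurable)
    (a := 2 + 2 * |T₀|) (b := 2) (c := 0) (by positivity) (by norm_num) le_rfl T₀ fun t ↦ ?_).1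
  rw [norm_mul, Complex.norm_real, Real.norm_eq_abs, abs_of_nonneg (gaussK_pos _).le]
  have := norm_riemannZeta_line_le' T₀ t
  have := (gaussK_pos (t - T₀)).le
  nlinarith [norm_nonneg (riemannZeta (1 / 2 + t * I))]

/-- `t ↦ ‖ζ(1/2+it)‖ K(t - T₀)` is integrable. [folklore] -/
theorem integrable_norm_riemannZeta_mul_gaussK (T₀ : ℝ) :
    Integrable fun t : ℝ ↦ ‖riemannZeta (1 / 2 + t * I)‖ * gaussK (t - T₀) := by
  have := (integrable_riemannZeta_mul_gaussK T₀).norm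
  refine this.congr (Eventually.of_forall fun t ↦ ?_)
  simp [abs_of_nonneg (gaussK_pos _).le]

/-- `t ↦ ‖ζ(1/2+it)‖² K(t - T₀)` is integrable. [folklore] -/
theorem integrable_norm_sq_riemannZeta_mul_gaussK (T₀ : ℝ) :
    Integrable fun t : ℝ ↦ ‖riemannZeta (1 / 2 + t * I)‖ ^ 2 * gaussK (t - T₀) := by
  refine (norm_integral_le_of_le_poly_gaussK
    (F := fun t : ℝ ↦ ‖riemannZeta (1 / 2 + t * I)‖ ^ 2 * gaussK (t - T₀))
    (((continuous_riemannZeta_line.norm.pow 2).mul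
      (continuous_gaussK.comp (continuous_sub_right T₀))).aestronglyMeasurable)
    (a := 2 * (2 + 2 * |T₀|) ^ 2) (b := 0) (c := 8) (by positivity) le_rfl (by norm_num) T₀ fun t ↦ ?_).1
  rw [Real.norm_eq_abs, abs_of_nonneg (mul_nonneg (sq_nonneg _) (gaussK_pos _).le)]
  have h := norm_riemannZeta_line_le' T₀ t
  have hK := (gaussK_pos (t - T₀)).le
  have h0 := norm_nonneg (riemannZeta (1 / 2 + t * I))
  have hsq : ‖riemannZeta (1 / 2 + t * I)‖ ^ 2 ≤ 2 * (2 + 2 * |T₀|) ^ 2 + 0 * |t - T₀| + 8 * (t - T₀) ^ 2 := by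
    calc ‖riemannZeta (1 / 2 + t * I)‖ ^ 2 ≤ (2 + 2 * |T₀| + 2 * |t - T₀|) ^ 2 := by gcongr
      _ ≤ 2 * (2 + 2 * |T₀|) ^ 2 + 0 * |t - T₀| + 8 * (t - T₀) ^ 2 := by
          rw [← sq_abs (t - T₀)]
          nlinarith [sq_nonneg (2 + 2 * |T₀| - 2 * |t - T₀|)]
  exact mul_le_mul_of_nonneg_right hsq hK

/-- `∫ K(t - T₀) dt = 4√π`. [folklore] -/
theorem integral_gaussK_shift (T₀ : ℝ) : ∫ t : ℝ, gaussK (t - T₀) = 4 * Real.sqrt π := by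
  rw [integral_sub_right_eq_self (μ := (volume : Measure ℝ)) gaussK T₀, integral_gaussK]

/-- **The smoothed first moment is bounded below**: for `T₀ ≥ 40000`,
`‖∫ ζ(1/2+it) e^{-(t-T₀)²/16} dt‖ ≥ √π` (the term `n = 1` contributes `4√π`, the terms `n ≥ 2`
at most `2√π`, and the three Euler–Maclaurin corrections at most `1 ≤ √π`). [folklore] -/
theorem sqrt_pi_le_norm_smoothedFirstMoment {T₀ : ℝ} (hT₀ : 40000 ≤ T₀) :
    Real.sqrt π ≤ ‖∫ t : ℝ, riemannZeta (1 / 2 + t * I) * (gaussK (t - T₀) : ℂ)‖ := by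
  have hT₀0 : 0 < T₀ := by linarith
  set N : ℕ := ⌊T₀⌋₊ + 1 with hNdef
  have hNT : T₀ < N := by rw [hNdef]; push_cast; exact Nat.lt_floor_add_one T₀
  have hNT' : (N : ℝ) ≤ T₀ + 1 := by
    rw [hNdef]; push_cast; linarith [Nat.floor_le hT₀0.le]
  have hN3 : 3 ≤ N := by
    have : (3 : ℝ) ≤ N := by linarith
    exact_mod_cast this
  have hN1 : 1 ≤ N := by omega
  have hN0 : N ≠ 0 := by omega
  have hNpos : (0 : ℝ) < N := by exact_mod_cast (show 0 < N by omega)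
  -- the four pieces
  have hA := norm_integral_emSum_sub_le (by omega : 2 ≤ N) T₀
  obtain ⟨hBi, hB⟩ := norm_integral_emBdry_le hN0 hT₀0
  obtain ⟨hCi, hC⟩ := norm_integral_emHalf_le hN0 T₀
  obtain ⟨hDi, hD⟩ := norm_integral_emTail_le hN3 T₀
  have hAi : Integrable fun t : ℝ ↦ emSum N t * (gaussK (t - T₀) : ℂ) := by
    simp only [emSum, Finset.sum_mul]
    exact integrable_finsetSum _ fun n hn ↦
      integrable_natCast_cpow_mul_gaussK (by have := (Finset.mem_Ico.1 hn).1; omega) T₀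
  -- decomposition of the smoothed moment
  have hdec : (∫ t : ℝ, riemannZeta (1 / 2 + t * I) * (gaussK (t - T₀) : ℂ)) =
      (∫ t : ℝ, emSum N t * (gaussK (t - T₀) : ℂ)) + (∫ t : ℝ, emBdry N t * (gaussK (t - T₀) : ℂ)) +
        (∫ t : ℝ, emHalf N t * (gaussK (t - T₀) : ℂ)) - (∫ t : ℝ, emTail N t * (gaussK (t - T₀) : ℂ)) := by
    have hABi : Integrable fun t : ℝ ↦ emSum N t * (gaussK (t - T₀) : ℂ) + emBdry N t * (gaussK (t - T₀) : ℂ) :=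
      hAi.add hBi
    have hABCi : Integrable fun t : ℝ ↦ emSum N t * (gaussK (t - T₀) : ℂ) + emBdry N t * (gaussK (t - T₀) : ℂ) +
        emHalf N t * (gaussK (t - T₀) : ℂ) := hABi.add hCi
    have heq : (fun t : ℝ ↦ riemannZeta (1 / 2 + t * I) * (gaussK (t - T₀) : ℂ)) = fun t : ℝ ↦
        emSum N t * (gaussK (t - T₀) : ℂ) + emBdry N t * (gaussK (t - T₀) : ℂ) +
          emHalf N t * (gaussK (t - T₀) : ℂ) - emTail N t * (gaussK (t - T₀) : ℂ) := by
      funext t; rw [riemannZeta_line_eq_em hN1 t]; ring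
    rw [heq, integral_sub hABCi hDi, integral_add hABi hCi, integral_add hAi hBi]
  -- sizes of the corrections
  have hsqN : Real.sqrt N ≤ T₀ / 198 := by
    rw [Real.sqrt_le_left (by positivity)]
    nlinarith
  have hB' : ‖∫ t : ℝ, emBdry N t * (gaussK (t - T₀) : ℂ)‖ ≤ 1 / 2 := by
    refine hB.trans ?_
    rw [show (1 / 2 : ℝ) = 99 * ((T₀ / 198) / T₀) by field_simp; norm_num]
    gcongr
  have hC' : ‖∫ t : ℝ, emHalf N t * (gaussK (t - T₀) : ℂ)‖ ≤ 1 / 4 := by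
    refine hC.trans ?_
    have h24 : (24 : ℝ) ≤ Real.sqrt N := by
      rw [Real.le_sqrt (by norm_num) hNpos.le]; linarith
    rw [Real.rpow_neg hNpos.le, ← Real.sqrt_eq_rpow]
    rw [show (1 / 4 : ℝ) = 6 * (24 : ℝ)⁻¹ by norm_num]
    gcongr
  have hD' : ‖∫ t : ℝ, emTail N t * (gaussK (t - T₀) : ℂ)‖ ≤ 1 / 4 := by
    refine hD.trans ?_
    have hπ : Real.sqrt π ≤ 2 := by
      rw [Real.sqrt_le_left (by norm_num)]; linarith [Real.pi_lt_four]
    have hN1' : (1 : ℝ) ≤ N := by exact_mod_cast hN1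
    have hpow : (N : ℝ) ^ (-(7 / 2 : ℝ)) ≤ ((N : ℝ) ^ 2)⁻¹ :=
      (Real.rpow_le_rpow_of_exponent_le hN1' (by norm_num : (-(7 / 2 : ℝ)) ≤ -(2 : ℝ))).trans_eq
        (by rw [Real.rpow_neg hNpos.le, Real.rpow_two])
    have hT₀abs : |T₀| = T₀ := abs_of_pos hT₀0
    rw [hT₀abs]
    calc 4 * Real.sqrt π / 7 * (9 + T₀) * (N : ℝ) ^ (-(7 / 2 : ℝ))
        ≤ 4 * 2 / 7 * (9 + T₀) * ((N : ℝ) ^ 2)⁻¹ := by gcongr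
      _ ≤ 4 * 2 / 7 * (9 + T₀) * (T₀ ^ 2)⁻¹ := by gcongr
      _ ≤ 1 / 4 := by
          rw [mul_inv_le_iff₀ (by positivity)]; nlinarith
  have hπ1 : 1 ≤ Real.sqrt π := by
    rw [Real.le_sqrt (by norm_num) (by positivity)]; linarith [Real.pi_gt_three]
  -- triangle inequality
  set LA := ∫ t : ℝ, emSum N t * (gaussK (t - T₀) : ℂ)
  set LB := ∫ t : ℝ, emBdry N t * (gaussK (t - T₀) : ℂ)
  set LC := ∫ t : ℝ, emHalf N t * (gaussK (t - T₀) : ℂ)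
  set LD := ∫ t : ℝ, emTail N t * (gaussK (t - T₀) : ℂ)
  set c : ℂ := ((4 * Real.sqrt π : ℝ) : ℂ) with hc
  set E : ℂ := (LA - c) + LB + LC - LD with hEdef
  have h4 : ‖c‖ = 4 * Real.sqrt π := by
    rw [hc, Complex.norm_real, Real.norm_eq_abs, abs_of_nonneg (by positivity)]
  have hE : ‖E‖ ≤ 2 * Real.sqrt π + 1 / 2 + 1 / 4 + 1 / 4 := by
    calc ‖E‖ ≤ ‖LA - c + LB + LC‖ + ‖LD‖ := norm_sub_le _ _
      _ ≤ ‖LA - c + LB‖ + ‖LC‖ + ‖LD‖ := by gcongr; exact norm_add_le _ _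
      _ ≤ ‖LA - c‖ + ‖LB‖ + ‖LC‖ + ‖LD‖ := by gcongr; exact norm_add_le _ _
      _ ≤ 2 * Real.sqrt π + 1 / 2 + 1 / 4 + 1 / 4 := by gcongr
  have hL : LA + LB + LC - LD = c + E := by rw [hEdef]; ring
  have h5 : ‖c‖ ≤ ‖c + E‖ + ‖E‖ := by
    have := norm_sub_le (c + E) E; rwa [add_sub_cancel_right] at this
  rw [hdec, hL]
  linarith

/-- AM–GM form of Cauchy–Schwarz: if `P ≤ λQ/2 + M/(2λ)` for all `λ > 0` then `P² ≤ MQ`. [folklore] -/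
theorem sq_le_mul_of_forall_amgm {P Q M : ℝ} (hP : 0 ≤ P) (hM : 0 < M) (hQ : 0 ≤ Q)
    (h : ∀ lam : ℝ, 0 < lam → P ≤ lam * Q / 2 + M / (2 * lam)) : P ^ 2 ≤ M * Q := by
  rcases hP.eq_or_lt with hP0 | hP0
  · rw [← hP0]; simpa using mul_nonneg hM.le hQ
  · have := h (M / P) (div_pos hM hP0)
    have e1 : M / (2 * (M / P)) = P / 2 := by field_simp
    rw [e1] at this
    have h4 : P ≤ M / P * Q := by linarith
    calc P ^ 2 = P * P := sq P
      _ ≤ (M / P * Q) * P := by gcongr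
      _ = M * Q := by field_simp

/-- **Local mean-square lower bound**: for `T₀ ≥ 40000`,
`√π/4 ≤ ∫ |ζ(1/2+it)|² e^{-(t-T₀)²/16} dt` (Cauchy–Schwarz from the smoothed first moment, with
`∫ e^{-(t-T₀)²/16} dt = 4√π`). [folklore] -/
theorem smoothedMeanSquare_ge {T₀ : ℝ} (hT₀ : 40000 ≤ T₀) :
    Real.sqrt π / 4 ≤ ∫ t : ℝ, ‖riemannZeta (1 / 2 + t * I)‖ ^ 2 * gaussK (t - T₀) := by
  set Z : ℝ → ℂ := fun t ↦ riemannZeta (1 / 2 + t * I) with hZ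
  set P : ℝ := ∫ t : ℝ, ‖Z t‖ * gaussK (t - T₀) with hP
  set Q : ℝ := ∫ t : ℝ, ‖Z t‖ ^ 2 * gaussK (t - T₀) with hQ
  have hPi := integrable_norm_riemannZeta_mul_gaussK T₀
  have hQi := integrable_norm_sq_riemannZeta_mul_gaussK T₀
  have hKi : Integrable fun t : ℝ ↦ gaussK (t - T₀) := integrable_gaussK.comp_sub_right T₀
  have hM : ∫ t : ℝ, gaussK (t - T₀) = 4 * Real.sqrt π := integral_gaussK_shift T₀
  have hπ0 : 0 < Real.sqrt π := Real.sqrt_pos.2 Real.pi_pos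
  -- `√π ≤ ‖L‖ ≤ P`
  have hL := sqrt_pi_le_norm_smoothedFirstMoment hT₀
  have hLP : ‖∫ t : ℝ, Z t * (gaussK (t - T₀) : ℂ)‖ ≤ P := by
    refine (norm_integral_le_integral_norm _).trans (le_of_eq ?_)
    refine integral_congr_ae (Eventually.of_forall fun t ↦ ?_)
    simp [abs_of_nonneg (gaussK_pos _).le, hZ]
  have hP0 : 0 ≤ P := integral_nonneg fun t ↦ mul_nonneg (norm_nonneg _) (gaussK_pos _).le
  have hQ0 : 0 ≤ Q := integral_nonneg fun t ↦ mul_nonneg (sq_nonneg _) (gaussK_pos _).le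
  -- AM–GM
  have hamgm : ∀ lam : ℝ, 0 < lam → P ≤ lam * Q / 2 + 4 * Real.sqrt π / (2 * lam) := by
    intro lam hlam
    have hpt : ∀ t, ‖Z t‖ * gaussK (t - T₀) ≤
        lam / 2 * (‖Z t‖ ^ 2 * gaussK (t - T₀)) + 1 / (2 * lam) * gaussK (t - T₀) := by
      intro t
      have hK := (gaussK_pos (t - T₀)).le
      have h0 : 0 ≤ (lam * ‖Z t‖ - 1) ^ 2 := sq_nonneg _
      have h1 : ‖Z t‖ ≤ lam / 2 * ‖Z t‖ ^ 2 + 1 / (2 * lam) := by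
        have e : lam / 2 * ‖Z t‖ ^ 2 + 1 / (2 * lam) = (lam ^ 2 * ‖Z t‖ ^ 2 + 1) / (2 * lam) := by
          field_simp
        rw [e, le_div_iff₀ (by positivity)]
        nlinarith
      calc ‖Z t‖ * gaussK (t - T₀) ≤ (lam / 2 * ‖Z t‖ ^ 2 + 1 / (2 * lam)) * gaussK (t - T₀) := by gcongr
        _ = lam / 2 * (‖Z t‖ ^ 2 * gaussK (t - T₀)) + 1 / (2 * lam) * gaussK (t - T₀) := by ring
    calc P ≤ ∫ t : ℝ, (lam / 2 * (‖Z t‖ ^ 2 * gaussK (t - T₀)) + 1 / (2 * lam) * gaussK (t - T₀)) :=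
          integral_mono hPi ((hQi.const_mul _).add (hKi.const_mul _)) hpt
      _ = lam / 2 * Q + 1 / (2 * lam) * (4 * Real.sqrt π) := by
          rw [integral_add (hQi.const_mul _) (hKi.const_mul _), integral_const_mul, integral_const_mul, hM]
      _ = lam * Q / 2 + 4 * Real.sqrt π / (2 * lam) := by ring
  have hsq := sq_le_mul_of_forall_amgm hP0 (by positivity) hQ0 hamgm
  have hPπ : Real.sqrt π ≤ P := hL.trans hLP
  have : Real.sqrt π ^ 2 ≤ 4 * Real.sqrt π * Q := (pow_le_pow_left₀ hπ0.le hPπ 2).trans hsq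
  rw [div_le_iff₀ (by norm_num : (0 : ℝ) < 4)]
  nlinarith


/-! ## From the local bound to `∫_T^{2T} |ζ(1/2+it)|² dt ≥ T/64` -/

/-- Kernel splitting: for `T₀ ∈ [5T/4, 7T/4]` and any real `t`,
`K(t - T₀) ≤ 𝟙_{(T,2T]}(t) K(t - T₀) + e^{-T²/1024} e^{-(t-T₀)²/64} · e^{(t-T₀)²/32}…` — precisely, off
`(T, 2T]` one has `|t - T₀| ≥ T/4`, whence `e^{-(t-T₀)²/32} ≤ e^{-T²/1024} e^{-(t-T₀)²/64}`. [folklore] -/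
theorem exp_neg_sq_div_32_le_of_not_mem {T T₀ t : ℝ} (h1 : 5 * T / 4 ≤ T₀) (h2 : T₀ ≤ 7 * T / 4)
    (ht : t ∉ Ioc T (2 * T)) :
    Real.exp (-(32 : ℝ)⁻¹ * (t - T₀) ^ 2) ≤
      Real.exp (-(T ^ 2 / 1024)) * Real.exp (-(64 : ℝ)⁻¹ * (t - T₀) ^ 2) := by
  rw [← Real.exp_add, Real.exp_le_exp]
  have hv : T / 4 ≤ |t - T₀| := by
    simp only [mem_Ioc, not_and_or, not_lt, not_le] at ht
    rcases ht with ht | ht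
    · rw [abs_sub_comm, abs_of_nonneg (by linarith)]; linarith
    · rw [abs_of_nonneg (by linarith)]; linarith
  have hT : T ≤ 4 * |t - T₀| := by linarith
  have hsq : (t - T₀) ^ 2 = |t - T₀| ^ 2 := (sq_abs _).symm
  rcases le_or_gt 0 T with hT0 | hT0
  · have : T ^ 2 ≤ 16 * (t - T₀) ^ 2 := by rw [hsq]; nlinarith [abs_nonneg (t - T₀)]
    nlinarith
  · -- `T < 0`: then `Ioc T (2T)` is irrelevant but the bound `T² ≤ 16 (t-T₀)²` still follows from
    -- `5T/4 ≤ T₀ ≤ 7T/4`, which forces `T ≥ 0`; contradiction.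
    linarith

/-- **Tail estimate.** For `T ≥ 16`, `T₀ ∈ [5T/4, 7T/4]`:
`∫ |ζ(1/2+it)|² K(t-T₀) dt ≤ ∫_T^{2T} |ζ(1/2+it)|² K(t-T₀) dt + 8448 T² e^{-T²/1024}`. [folklore] -/
theorem smoothedMeanSquare_le_interval_add {T T₀ : ℝ} (hT : 16 ≤ T) (h1 : 5 * T / 4 ≤ T₀)
    (h2 : T₀ ≤ 7 * T / 4) :
    ∫ t : ℝ, ‖riemannZeta (1 / 2 + t * I)‖ ^ 2 * gaussK (t - T₀) ≤
      (∫ t in T..(2 * T), ‖riemannZeta (1 / 2 + t * I)‖ ^ 2 * gaussK (t - T₀)) +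
        8448 * T ^ 2 * Real.exp (-(T ^ 2 / 1024)) := by
  set Z : ℝ → ℝ := fun t ↦ ‖riemannZeta (1 / 2 + t * I)‖ ^ 2 with hZ
  have hT0 : 0 ≤ T := by linarith
  have hT₀0 : 0 ≤ T₀ := by linarith
  set α : ℝ := 2 * (2 + 2 * |T₀|) ^ 2 with hα
  -- the constant in front of the wide Gaussian
  have hαT : (α + 4 * 0 + 32 * 8) ≤ 66 * T ^ 2 := by
    rw [hα, abs_of_nonneg hT₀0]
    nlinarith
  -- pointwise majorant
  set G : ℝ → ℝ := fun t ↦ (Ioc T (2 * T)).indicator (fun t ↦ Z t * gaussK (t - T₀)) t +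
    66 * T ^ 2 * Real.exp (-(T ^ 2 / 1024)) * Real.exp (-(64 : ℝ)⁻¹ * (t - T₀) ^ 2) with hG
  have hpt : ∀ t, Z t * gaussK (t - T₀) ≤ G t := by
    intro t
    by_cases ht : t ∈ Ioc T (2 * T)
    · rw [hG]; simp only [indicator_of_mem ht]
      have : 0 ≤ 66 * T ^ 2 * Real.exp (-(T ^ 2 / 1024)) * Real.exp (-(64 : ℝ)⁻¹ * (t - T₀) ^ 2) := by
        positivity
      linarith
    · rw [hG]; simp only [indicator_of_notMem ht, zero_add]
      have hZle : Z t ≤ α + 4 * 0 * |t - T₀| + 8 * (t - T₀) ^ 2 := by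
        have h := norm_riemannZeta_line_le' T₀ t
        have h0 := norm_nonneg (riemannZeta (1 / 2 + t * I))
        calc Z t ≤ (2 + 2 * |T₀| + 2 * |t - T₀|) ^ 2 := by rw [hZ]; dsimp only; gcongr
          _ ≤ α + 4 * 0 * |t - T₀| + 8 * (t - T₀) ^ 2 := by
              rw [hα, ← sq_abs (t - T₀)]
              nlinarith [sq_nonneg (2 + 2 * |T₀| - 2 * |t - T₀|)]
      have hstep1 : Z t * gaussK (t - T₀) ≤ (α + 4 * 0 + 32 * 8) * Real.exp (-(32 : ℝ)⁻¹ * (t - T₀) ^ 2) := by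
        refine le_trans ?_ (poly_mul_gaussK_le (a := α) (b := 0) (c := 8) (by positivity) le_rfl (by norm_num) (t - T₀))
        have := (gaussK_pos (t - T₀)).le
        have h' : 4 * 0 * |t - T₀| = 0 * |t - T₀| := by ring
        rw [h'] at hZle
        exact mul_le_mul_of_nonneg_right hZle this
      have hstep2 := exp_neg_sq_div_32_le_of_not_mem h1 h2 ht
      have hpos : 0 ≤ α + 4 * 0 + 32 * 8 := by positivity
      calc Z t * gaussK (t - T₀) ≤ (α + 4 * 0 + 32 * 8) * Real.exp (-(32 : ℝ)⁻¹ * (t - T₀) ^ 2) := hstep1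
        _ ≤ (66 * T ^ 2) * (Real.exp (-(T ^ 2 / 1024)) * Real.exp (-(64 : ℝ)⁻¹ * (t - T₀) ^ 2)) := by
            gcongr
        _ = 66 * T ^ 2 * Real.exp (-(T ^ 2 / 1024)) * Real.exp (-(64 : ℝ)⁻¹ * (t - T₀) ^ 2) := by ring
  -- integrability
  have hQi := integrable_norm_sq_riemannZeta_mul_gaussK T₀
  have hWi : Integrable fun t : ℝ ↦ Real.exp (-(64 : ℝ)⁻¹ * (t - T₀) ^ 2) :=
    (integrable_exp_neg_mul_sq (b := (64 : ℝ)⁻¹) (by norm_num)).comp_sub_right T₀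
  have hIi : Integrable fun t : ℝ ↦ (Ioc T (2 * T)).indicator (fun t ↦ Z t * gaussK (t - T₀)) t :=
    (hQi.indicator measurableSet_Ioc)
  have hGi : Integrable G := hIi.add (hWi.const_mul _)
  -- integrate
  have hW : ∫ t : ℝ, Real.exp (-(64 : ℝ)⁻¹ * (t - T₀) ^ 2) = 8 * Real.sqrt π := by
    rw [integral_sub_right_eq_self (μ := (volume : Measure ℝ)) (fun t ↦ Real.exp (-(64 : ℝ)⁻¹ * t ^ 2)) T₀,
      integral_gaussian, show π / (64 : ℝ)⁻¹ = 8 ^ 2 * π by field_simp; norm_num,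
      Real.sqrt_mul (by norm_num), Real.sqrt_sq (by norm_num)]
  have hπ : Real.sqrt π ≤ 2 := by
    rw [Real.sqrt_le_left (by norm_num)]; linarith [Real.pi_lt_four]
  calc ∫ t : ℝ, Z t * gaussK (t - T₀) ≤ ∫ t : ℝ, G t := integral_mono hQi hGi hpt
    _ = (∫ t in Ioc T (2 * T), Z t * gaussK (t - T₀)) +
          66 * T ^ 2 * Real.exp (-(T ^ 2 / 1024)) * (8 * Real.sqrt π) := by
        rw [hG, integral_add hIi (hWi.const_mul _), integral_indicator measurableSet_Ioc,
          integral_const_mul, hW]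
    _ ≤ (∫ t in T..(2 * T), Z t * gaussK (t - T₀)) + 8448 * T ^ 2 * Real.exp (-(T ^ 2 / 1024)) := by
        rw [intervalIntegral.integral_of_le (by linarith)]
        have : 0 ≤ T ^ 2 * Real.exp (-(T ^ 2 / 1024)) := by positivity
        nlinarith

/-- `8448 T² e^{-T²/1024} ≤ 1/5` for `T ≥ 3 · 10^5` (from `e^x ≥ x²/2`). [folklore] -/
theorem tail_const_le {T : ℝ} (hT : 300000 ≤ T) : 8448 * T ^ 2 * Real.exp (-(T ^ 2 / 1024)) ≤ 1 / 5 := by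
  have hx : (0 : ℝ) ≤ T ^ 2 / 1024 := by positivity
  have h := Real.quadratic_le_exp_of_nonneg hx
  rw [Real.exp_neg]
  have hpos : 0 < Real.exp (T ^ 2 / 1024) := Real.exp_pos _
  rw [mul_inv_le_iff₀ hpos]
  have hT2 : (300000 : ℝ) ^ 2 ≤ T ^ 2 := by gcongr
  nlinarith

/-- **Localised bound on `[T, 2T]`.** For `T ≥ 3·10^5` and `T₀ ∈ [5T/4, 7T/4]`,
`√π/8 ≤ ∫_T^{2T} |ζ(1/2+it)|² K(t - T₀) dt`. [folklore] -/
theorem interval_smoothedMeanSquare_ge {T T₀ : ℝ} (hT : 300000 ≤ T) (h1 : 5 * T / 4 ≤ T₀)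
    (h2 : T₀ ≤ 7 * T / 4) :
    Real.sqrt π / 8 ≤ ∫ t in T..(2 * T), ‖riemannZeta (1 / 2 + t * I)‖ ^ 2 * gaussK (t - T₀) := by
  have hloc := smoothedMeanSquare_ge (T₀ := T₀) (by linarith)
  have htail := smoothedMeanSquare_le_interval_add (T := T) (by linarith) h1 h2
  have hc := tail_const_le hT
  have hπ : 8 / 5 ≤ Real.sqrt π := by
    rw [Real.le_sqrt (by norm_num) (by positivity)]; linarith [Real.pi_gt_three]
  linarith

/-- The two-variable weight `(T₀, t) ↦ |ζ(1/2+it)|² K(t - T₀)` is continuous. [folklore] -/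
theorem continuous_weight :
    Continuous (Function.uncurry fun T₀ t : ℝ ↦ ‖riemannZeta (1 / 2 + t * I)‖ ^ 2 * gaussK (t - T₀)) := by
  refine Continuous.mul ?_ ?_
  · exact ((continuous_riemannZeta_line.comp continuous_snd).norm).pow 2
  · exact continuous_gaussK.comp (continuous_snd.sub continuous_fst)

/-- `∫_a^b K(t - T₀) dT₀ ≤ 4√π`. [folklore] -/
theorem setIntegral_gaussK_le (t : ℝ) (s : Set ℝ) : ∫ T₀ in s, gaussK (t - T₀) ≤ 4 * Real.sqrt π := by
  have hi : Integrable fun T₀ : ℝ ↦ gaussK (t - T₀) := by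
    have := integrable_gaussK.comp_sub_left t
    exact this
  calc ∫ T₀ in s, gaussK (t - T₀) ≤ ∫ T₀ : ℝ, gaussK (t - T₀) :=
        setIntegral_le_integral hi (Eventually.of_forall fun T₀ ↦ (gaussK_pos _).le)
    _ = 4 * Real.sqrt π := by
        rw [integral_sub_left_eq_self gaussK volume t, integral_gaussK]

/-- **Mean-square lower bound on dyadic intervals** (a weak, fully explicit form of the
Hardy–Littlewood mean value theorem `∫_0^T |ζ(1/2+it)|² dt ∼ T log T`, Titchmarsh Thm. 7.3):
for `T ≥ 3·10^5`, `T/64 ≤ ∫_T^{2T} |ζ(1/2+it)|² dt`. Proof: average the localised bound over the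
centres `T₀ ∈ [5T/4, 7T/4]` and use `∫ K(t - T₀) dT₀ ≤ 4√π` (Fubini).
[cite: Titchmarsh1986, Theorem 7.3 (weak form)] -/
theorem integral_norm_sq_riemannZeta_Icc_ge {T : ℝ} (hT : 300000 ≤ T) :
    T / 64 ≤ ∫ t in T..(2 * T), ‖riemannZeta (1 / 2 + t * I)‖ ^ 2 := by
  have hT0 : 0 < T := by linarith
  set a : ℝ := 5 * T / 4 with ha
  set b : ℝ := 7 * T / 4 with hb
  have hab : a ≤ b := by rw [ha, hb]; linarith
  set Z : ℝ → ℝ := fun t ↦ ‖riemannZeta (1 / 2 + t * I)‖ ^ 2 with hZ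
  set f : ℝ → ℝ → ℝ := fun T₀ t ↦ Z t * gaussK (t - T₀) with hf
  -- integrability on the rectangle
  have hI : Integrable (Function.uncurry f)
      ((volume.restrict (Ioc a b)).prod (volume.restrict (Ioc T (2 * T)))) := by
    rw [Measure.prod_restrict, ← Measure.volume_eq_prod]
    have hc : IntegrableOn (Function.uncurry f) (Icc a b ×ˢ Icc T (2 * T)) volume :=
      (continuous_weight.continuousOn).integrableOn_compact (isCompact_Icc.prod isCompact_Icc)
    exact hc.mono_set (prod_mono Ioc_subset_Icc_self Ioc_subset_Icc_self)
  have hswap := integral_integral_swap hI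
  -- lower bound for the `T₀`-average
  have hlow : Real.sqrt π / 8 * (b - a) ≤ ∫ T₀ in Ioc a b, ∫ t in Ioc T (2 * T), f T₀ t := by
    have hconst : ∫ _ in Ioc a b, Real.sqrt π / 8 = Real.sqrt π / 8 * (b - a) := by
      rw [setIntegral_const, Real.volume_real_Ioc_of_le hab, smul_eq_mul, mul_comm]
    rw [← hconst]
    refine setIntegral_mono_on (integrableOn_const (by simp)) hI.integral_prod_left measurableSet_Ioc
      fun T₀ hT₀ ↦ ?_
    have := interval_smoothedMeanSquare_ge hT (T₀ := T₀) (by rw [ha] at hT₀; exact hT₀.1.le) (by rw [hb] at hT₀; exact hT₀.2)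
    rwa [intervalIntegral.integral_of_le (by linarith)] at this
  -- upper bound for the swapped integral
  have hup : (∫ t in Ioc T (2 * T), ∫ T₀ in Ioc a b, f T₀ t) ≤
      ∫ t in Ioc T (2 * T), Z t * (4 * Real.sqrt π) := by
    refine setIntegral_mono_on hI.integral_prod_right ?_ measurableSet_Ioc fun t _ ↦ ?_
    · exact (continuous_riemannZeta_line.norm.pow 2).continuousOn.integrableOn_compact isCompact_Icc
        |>.mono_set Ioc_subset_Icc_self |>.mul_const _
    · simp only [hf]
      rw [integral_const_mul]
      exact mul_le_mul_of_nonneg_left (setIntegral_gaussK_le t _) (by positivity)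
  have hfin : Real.sqrt π / 8 * (b - a) ≤ 4 * Real.sqrt π * ∫ t in T..(2 * T), Z t := by
    rw [intervalIntegral.integral_of_le (by linarith), ← integral_const_mul]
    calc Real.sqrt π / 8 * (b - a) ≤ ∫ T₀ in Ioc a b, ∫ t in Ioc T (2 * T), f T₀ t := hlow
      _ = ∫ t in Ioc T (2 * T), ∫ T₀ in Ioc a b, f T₀ t := hswap
      _ ≤ ∫ t in Ioc T (2 * T), Z t * (4 * Real.sqrt π) := hup
      _ = ∫ t in Ioc T (2 * T), 4 * Real.sqrt π * Z t := by
          congr 1; funext t; ring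
  have hπ0 : 0 < Real.sqrt π := Real.sqrt_pos.2 Real.pi_pos
  have hba : b - a = T / 2 := by rw [ha, hb]; ring
  rw [hba] at hfin
  by_contra hcon
  push Not at hcon
  nlinarith

end ZetaMeanSquare

/-- **Mean-square lower bound for `ζ` on dyadic intervals**, in the form used downstream:
there are `c > 0` and `T₁` with `c T ≤ ∫_T^{2T} |ζ(1/2+it)|² dt` for all `T ≥ T₁`
(here `c = 1/64`, `T₁ = 3·10^5`). A weak consequence of the Hardy–Littlewood mean value theorem
(Titchmarsh Thm. 7.3), proved here from scratch. [cite: Titchmarsh1986, Theorem 7.3 (weak form)] -/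
theorem exists_integral_norm_sq_riemannZeta_Icc_ge :
    ∃ c : ℝ, 0 < c ∧ ∃ T₁ : ℝ, ∀ T : ℝ, T₁ ≤ T →
      c * T ≤ ∫ t in T..(2 * T), ‖riemannZeta (1 / 2 + t * I)‖ ^ 2 :=
  ⟨1 / 64, by norm_num, 300000, fun T hT ↦ by
    have := ZetaMeanSquare.integral_norm_sq_riemannZeta_Icc_ge hT; linarith⟩

end Literature.NumberTheory.LFunctions
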